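import Summits.QuantumFields.YangMills.Theorems.CurvatureBoostCovariance.Negative.Unbundled
import Summits.QuantumFields.YangMills.Theorems.NPointIsotropy.Negative.NPointRegularJunk
import Summits.QuantumFields.YangMills.Theorems.MirrorModularBoostsCurvatureBoostCovarianceRayPositivityCore
import Summits.QuantumFields.YangMills.Theorems.MirrorModularBoostsPlanarSpectralConeDensityHelpers
import Literature.MathematicalPhysics.QuantumFieldTheory.OSReconstructionNoE1

/-!
# The reserve-aware lower block does not grow — stub `stub_lowerBlock`

Line `Sketch` of crux `MirrorModularBoosts.SoftKernelBoostCovariance` (stmt-QuantumFields-14999), stub (T5) of the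
registered skeleton `Cruxes/SoftKernelBoostCovariance/Lines/Sketch.lean`.  Model-blind Osterwalder–Schrader bookkeeping
over the `e₀`-reconstruction `h : OSReconstructionNoE1 S₁.toLabelled` of a one-species Schwinger family `S₁` on `ℝ⁴`
(`h.fieldVec m (fun _ => ()) W hW = Ψ_W`, `h.transfer t = e^{-tH}`, `h.translate a = U(a⃗)`).

**Statement** (`stub_lowerBlock`).  Let `N` be a cone family of `h` (`‖N p‖ ≤ 1` and weakly holomorphic on the
tube `{|Im b| < Re t}`, `N(t, b) = e^{-tH} U(b e₁)` at real `t > 0`), `S₁` translation invariant on `⁰𝒮` and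
`𝔖_{m+m}` invariant on `⁰𝒮` under the rotations `R_θ = planeRot 0 θ` of the `(x₀,x₁)`-plane.  Write
`W_θ^t := τ_{-(R_θ c + t e₀)} (R_θ · Y)` (the tail `Y` seen from the rotating centre `R_θ c`, pulled down by `t`).
If `V'` is holomorphic on the rectangle `{|Re ζ| < ε, |Im ζ| < R}` with real values `V' θ = Ψ_{W_θ^w}` (`w > 0`)
and `w e^R ≤ g`, then `‖V' ζ‖ ≤ ‖Ψ_{W_θ^g}‖` at `θ = Re ζ`: no growth in `Im ζ`.

**Proof** (the pencil identity of `RayPositivity.pencil_eq_inner` with a matrix element of the cone family in place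
of a trigonometric polynomial).  Fix `θ = Re ζ`, `ε' = ε - |θ|`.
1. `Λ(s) = ⟪V'(θ - s̄), V'(θ + s)⟫` is holomorphic on the rectangle `D = {|Re s| < ε', |Im s| < R}` (the bra is
   antiholomorphic in the conjugate-linear slot, `RayPositivity.hasDerivAt_innerSL_neg_conj`).
2. For real `s`: `Λ(s) = 𝔖_{m+m}(Θ(W_{θ-s}^w)* ⊗ W_{θ+s}^w)` (`inner_fieldVec_fieldVec`).  In the rotating frame
   `Z = τ_{-R_θ c⃗}(R_θ · Y)` one has `W_{θ±s}^w = τ_{-w e₀}(R_{±s} · Z)`, `W_θ^g = τ_{-g e₀} Z`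
   (`LowerBlock.block_add/block_self`), and the KEY GEOMETRY (inside `LowerBlock.pairing`, a Schwartz-map
   identity checked in coordinates) `τ_{-w e₀}(Θ(W_{θ-s}^w)* ⊗ W_{θ+s}^w) = R_s · τ_{-g e₀}(Θ(W_θ^g)* ⊗ τ_v W_θ^g)`,
   `v = (2g - 2w cos s) e₀ - 2w sin s e₁`; translation invariance (twice) and planar invariance (once), all on
   off-diagonal functions (`isOffDiagonal_appendTensor_osAdjoint`; `⁰𝒮` is translation stable), give
   `Λ(s) = 𝔖(Θ(W_θ^g)* ⊗ τ_v W_θ^g) = ⟪Ψ, e^{-(2g - 2w cos s)H} U(-2w sin s e₁) Ψ⟫ = ⟪Ψ, N(2g - 2w cos s, -2w sin s) Ψ⟫`,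
   `Ψ = Ψ_{W_θ^g}` (`transfer_fieldVec`, `translate_fieldVec`).
3. `Φ(s) = ⟪Ψ, N(2g - 2w cos s, -2w sin s) Ψ⟫` is holomorphic on `D`: the entire curve stays in the tube because
   `|Im(2w sin s)| ≤ 2w sinh|Im s|`, `Re(2g - 2w cos s) ≥ 2g - 2w cosh(Im s)` and `w e^{|Im s|} < w e^R ≤ g`
   (`LowerBlock.curve_mem_tube`).
4. Identity theorem on the convex open `D` (`LowerBlock.inner_eq_of_ofReal`): `Λ = Φ` on `D`.  At `s = i Im ζ`:
   `θ - s̄ = θ + s = ζ`, so `‖V' ζ‖² = Λ(s) = Φ(s) ≤ ‖Ψ‖ ‖N‖ ‖Ψ‖ ≤ ‖Ψ‖²`.  (The hypothesis on the `2g`-advanced blocks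
   is not needed: `⁰𝒮` is translation stable, `LowerBlock.isOffDiagonal_translateMulti`.)

References: K. Osterwalder, R. Schrader, CMP 31 (1973) §4 and CMP 42 (1975) §V (Euclidean covariance by analytic
continuation in the angle); J. Glimm, A. Jaffe, *Quantum Physics* (2nd ed. 1987), §19.5–19.7.
-/

noncomputable section

namespace Summit.QuantumFields.YangMills.Theorems.SoftKernelBoostCovariance.Sketch

open scoped InnerProductSpace SchwartzMap ComplexConjugate
open Filter Topology
open Literature.MathematicalPhysics.QuantumLattice Literature.MathematicalPhysics.AQFT
  Literature.MathematicalPhysics.QuantumFieldTheory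
open Summit.QuantumFields.YangMills.Theorems.NPointIsotropy.Negative (E4)
open Summit.QuantumFields.YangMills.Theorems.CurvatureBoostCovariance.Negative (Translations)
open Summit.QuantumFields.YangMills.Theorems.CurvatureBoostCovariance.BoostsInheritMirrors.RayPositivity
  (hasDerivAt_innerSL_neg_conj linActMulti_planeRot_planeRot)
open Summit.QuantumFields.YangMills.Cruxes.PlanarSpectralCone.PositivityDiscToOperatorCone.Density
  (inner_fieldVec_fieldVec_one fieldVec_congr)

namespace LowerBlock

/-! ## 1. The pencil identity on a rectangle -/

section Pencil

variable {H : Type*} [NormedAddCommGroup H] [InnerProductSpace ℂ H]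

/-- The rectangle `{|Re z| < ε ∧ |Im z| < R}` is open. -/
theorem isOpen_rect (ε R : ℝ) : IsOpen {z : ℂ | |z.re| < ε ∧ |z.im| < R} :=
  (isOpen_lt (continuous_abs.comp Complex.continuous_re) continuous_const).and
    (isOpen_lt (continuous_abs.comp Complex.continuous_im) continuous_const)

/-- The rectangle `{|Re z| < ε ∧ |Im z| < R}` is convex. -/
theorem convex_rect (ε R : ℝ) : Convex ℝ {z : ℂ | |z.re| < ε ∧ |z.im| < R} := by
  -- adapted from `HilbertVitali.convex_rect` (sibling stub file of this line)
  have hre : IsLinearMap ℝ fun w : ℂ => w.re :=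
    ⟨fun u v => Complex.add_re u v, fun c u => Complex.smul_re c u⟩
  have him : IsLinearMap ℝ fun w : ℂ => w.im :=
    ⟨fun u v => Complex.add_im u v, fun c u => Complex.smul_im c u⟩
  have hset : {z : ℂ | |z.re| < ε ∧ |z.im| < R} =
      ({z : ℂ | -ε < z.re} ∩ {z : ℂ | z.re < ε}) ∩ ({z : ℂ | -R < z.im} ∩ {z : ℂ | z.im < R}) := by
    ext z
    simp only [Set.mem_setOf_eq, Set.mem_inter_iff, abs_lt]
  rw [hset]
  exact ((convex_halfSpace_gt hre _).inter (convex_halfSpace_lt hre _)).inter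
    ((convex_halfSpace_gt him _).inter (convex_halfSpace_lt him _))

/-- **Pencil identity on a rectangle.**  If `V : ℂ → H` and `Φ : ℂ → ℂ` are holomorphic on the rectangle
`D = {|Re z| < ε ∧ |Im z| < R}` (`ε, R > 0`) and `⟪V(-s), V(s)⟫ = Φ(s)` for real `|s| < ε`, then
`⟪V(-z̄), V(z)⟫ = Φ(z)` on all of `D` (the left side is holomorphic by `hasDerivAt_innerSL_neg_conj`; identity
theorem on the convex open `D`, the real segment accumulating at `0`). -/
theorem inner_eq_of_ofReal {ε R : ℝ} (hε : 0 < ε) (hR : 0 < R) {V : ℂ → H} {Φ : ℂ → ℂ}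
    (hV : DifferentiableOn ℂ V {z : ℂ | |z.re| < ε ∧ |z.im| < R})
    (hΦ : DifferentiableOn ℂ Φ {z : ℂ | |z.re| < ε ∧ |z.im| < R})
    (hreal : ∀ s : ℝ, |s| < ε → ⟪V (-(s : ℂ)), V s⟫_ℂ = Φ s) {z : ℂ}
    (hz : |z.re| < ε ∧ |z.im| < R) : ⟪V (-conj z), V z⟫_ℂ = Φ z := by
  -- adapted from `RayPositivity.pencil_eq_inner` (…CurvatureBoostCovarianceRayPositivityCore.lean)
  set D : Set ℂ := {z : ℂ | |z.re| < ε ∧ |z.im| < R} with hD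
  have hDo : IsOpen D := isOpen_rect ε R
  have hmemD : ∀ z ∈ D, -conj z ∈ D := fun z hz => by
    simpa only [hD, Set.mem_setOf_eq, Complex.neg_re, Complex.conj_re, abs_neg, Complex.neg_im,
      Complex.conj_im, neg_neg] using hz
  set g : ℂ → ℂ := fun z => ⟪V (-conj z), V z⟫_ℂ - Φ z with hg
  have hgd : DifferentiableOn ℂ g D := by
    intro z hz
    have hVat : HasDerivAt V (deriv V (-conj z)) (-conj z) :=
      ((hV _ (hmemD z hz)).differentiableAt (hDo.mem_nhds (hmemD z hz))).hasDerivAt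
    have hWat : HasDerivAt V (deriv V z) z :=
      ((hV _ hz).differentiableAt (hDo.mem_nhds hz)).hasDerivAt
    have h2 : DifferentiableAt ℂ (fun s => (innerSL ℂ (V (-conj s))) (V s)) z :=
      ((hasDerivAt_innerSL_neg_conj hVat).clm_apply hWat).differentiableAt
    simp only [innerSL_apply_apply] at h2
    exact (h2.sub ((hΦ _ hz).differentiableAt (hDo.mem_nhds hz))).differentiableWithinAt
  have hga : AnalyticOnNhd ℂ g D := hgd.analyticOnNhd hDo
  -- `g` vanishes on the real segment, which accumulates at `0`
  have hfreq : ∃ᶠ s in 𝓝[≠] (0 : ℂ), g s = 0 := by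
    have htend : Tendsto (fun s : ℝ => (s : ℂ)) (𝓝[>] 0) (𝓝[≠] 0) := by
      have h1 : Tendsto (fun s : ℝ => (s : ℂ)) (𝓝[>] 0) (𝓝[{0}ᶜ] ((0 : ℝ) : ℂ)) :=
        Complex.continuous_ofReal.continuousWithinAt.tendsto_nhdsWithin fun s hs =>
          Complex.ofReal_ne_zero.2 (ne_of_gt hs)
      simpa using h1
    have hev : ∀ᶠ s : ℝ in 𝓝[>] 0, g (s : ℂ) = 0 := by
      have : ∀ᶠ s : ℝ in 𝓝[>] (0 : ℝ), s < ε :=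
        (eventually_lt_nhds hε).filter_mono nhdsWithin_le_nhds
      filter_upwards [this, self_mem_nhdsWithin] with s hs hs0
      have habs : |s| < ε := abs_lt.2 ⟨by linarith [Set.mem_Ioi.1 hs0], hs⟩
      simp only [hg, Complex.conj_ofReal]
      rw [hreal s habs, sub_self]
    exact htend.frequently hev.frequently
  have h0D : (0 : ℂ) ∈ D := by simp [hD, hε, hR]
  have hzero := hga.eqOn_zero_of_preconnected_of_frequently_eq_zero
    (convex_rect ε R).isPreconnected h0D hfreq
  simpa only [hg, Pi.zero_apply, sub_eq_zero] using hzero hz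

end Pencil

/-! ## 2. The curve `s ↦ (2g - 2w cos s, -2w sin s)` stays in the tube `{|Im b| < Re t}` -/

/-- **The entire curve `s ↦ (2g - 2w cos s, -2w sin s)` maps the strip `|Im s| < R` into the tube** when
`w > 0` and `w e^R ≤ g`: `|Im(2w sin s)| ≤ 2w sinh|Im s|`, `Re(2g - 2w cos s) ≥ 2g - 2w cosh(Im s)` and
`cosh y + sinh|y| = e^{|y|}`, `w e^{|Im s|} < w e^R ≤ g`. -/
theorem curve_mem_tube {w g R : ℝ} (hw : 0 < w) (hwg : w * Real.exp R ≤ g) {z : ℂ} (hz : |z.im| < R) :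
    |(-2 * (w : ℂ) * Complex.sin z).im| < (2 * (g : ℂ) - 2 * (w : ℂ) * Complex.cos z).re := by
  -- `Im sin z = cos x sinh y`, `Re cos z = cos x cosh y` (cf. `ChainItem.sin_im/cos_re` of `OSBoostChains`)
  have him : (-2 * (w : ℂ) * Complex.sin z).im = -2 * w * (Real.cos z.re * Real.sinh z.im) := by
    rw [Complex.sin_eq]
    simp [Complex.cos_ofReal_re, Complex.sinh_ofReal_re, Complex.sin_ofReal_im, Complex.cosh_ofReal_im,
      Complex.mul_im]
  have hre : (2 * (g : ℂ) - 2 * (w : ℂ) * Complex.cos z).re =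
      2 * g - 2 * w * (Real.cos z.re * Real.cosh z.im) := by
    rw [Complex.cos_eq]
    simp [Complex.cos_ofReal_re, Complex.cosh_ofReal_re, Complex.sin_ofReal_im, Complex.sinh_ofReal_im,
      Complex.mul_re]
  rw [him, hre]
  have hexp : w * Real.exp |z.im| < g :=
    lt_of_lt_of_le (mul_lt_mul_of_pos_left (Real.exp_lt_exp.2 hz) hw) hwg
  have hkey : Real.cosh z.im + |Real.sinh z.im| = Real.exp |z.im| := by
    rw [Real.abs_sinh, ← Real.cosh_abs, Real.cosh_add_sinh]
  have hlt : w * Real.cosh z.im + w * |Real.sinh z.im| < g := by rw [← mul_add, hkey]; exact hexp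
  have hcc : w * (Real.cos z.re * Real.cosh z.im) ≤ w * Real.cosh z.im :=
    mul_le_mul_of_nonneg_left (mul_le_of_le_one_left (Real.cosh_pos _).le (Real.cos_le_one _)) hw.le
  have habs : |-2 * w * (Real.cos z.re * Real.sinh z.im)| ≤ 2 * w * |Real.sinh z.im| := by
    rw [abs_mul, abs_mul, abs_mul, abs_neg, abs_two, abs_of_pos hw]
    exact mul_le_mul_of_nonneg_left (mul_le_of_le_one_left (abs_nonneg _) (Real.abs_cos_le_one _))
      (by positivity)
  linarith

/-! ## 3. Geometry of the rotating blocks in `ℝ⁴` -/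

/-- `⁰𝒮` is stable under diagonal translations (`iteratedFDeriv_comp_sub`; the coincidence locus is
translation invariant). -/
theorem isOffDiagonal_translateMulti {n : ℕ} {F : 𝓢((Fin n → E4), ℂ)} (hF : IsOffDiagonal F) (a : E4) :
    IsOffDiagonal (translateMulti a F) := by
  -- adapted from `…ParabolicTrajectoryContinuumLimitOnTrajectoryStubOSLegsB_Limit.lean`
  intro x hx k
  have hfun : (translateMulti a F : (Fin n → E4) → ℂ) = fun z => F (z - fun _ => a) := by
    funext z; rw [translateMulti_apply]; rfl
  rw [hfun, iteratedFDeriv_comp_sub]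
  refine hF _ ?_ k
  obtain ⟨i, j, hij, h⟩ := hx
  exact ⟨i, j, hij, by simp [h]⟩

variable {m : ℕ}

/-- **The real pairing identity** (KEY GEOMETRY).  For any `Z` (below: `Z = τ_{-R_θ c⃗}(R_θ · Y)`), with
`W₊ = τ_{-w e₀}(R_s · Z)`, `W₋ = τ_{-w e₀}(R_{-s} · Z)`, `Ỹ = τ_{-g e₀} Z` time-ordered and `0 ≤ w ≤ g`:
`𝔖(ΘW₋* ⊗ W₊) = 𝔖(ΘỸ* ⊗ τ_v Ỹ)`, `v = (2g - 2w cos s) e₀ - 2w sin s e₁`.  Translation by `-w e₀` (`⁰𝒮`: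
`isOffDiagonal_appendTensor_osAdjoint`), the Schwartz-map identity
`τ_{-w e₀}(ΘW₋* ⊗ W₊) = R_s · τ_{-g e₀}(ΘỸ* ⊗ τ_v Ỹ)` (checked in coordinates: `Θ R_s = R_{-s} Θ`,
`R_s τ_a = τ_{R_s a} R_s`, `R_{-s} e₀ = (cos s, sin s)`), planar invariance, translation by `g e₀`. -/
theorem pairing (S₁ : SchwingerFamily E4) (hT : Translations S₁)
    (hrot : ∀ (θ : ℝ) (F : 𝓢((Fin (m + m) → E4), ℂ)), IsOffDiagonal F →
      S₁ (m + m) (linActMulti (planeRot (0 : Fin 3) θ) F) = S₁ (m + m) F)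
    (Z : 𝓢((Fin m → E4), ℂ)) {w g : ℝ} (hw : 0 ≤ w) (hwg : w ≤ g) (s : ℝ)
    (hWm : IsTimeOrdered (translateMulti (-(w • EuclideanSpace.single 0 1 : E4))
      (linActMulti (planeRot (0 : Fin 3) (-s)) Z)))
    (hWp : IsTimeOrdered (translateMulti (-(w • EuclideanSpace.single 0 1 : E4))
      (linActMulti (planeRot (0 : Fin 3) s) Z)))
    (hY : IsTimeOrdered (translateMulti (-(g • EuclideanSpace.single 0 1 : E4)) Z)) :
    S₁ (m + m) ((osAdjoint (translateMulti (-(w • EuclideanSpace.single 0 1 : E4))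
        (linActMulti (planeRot (0 : Fin 3) (-s)) Z))).appendTensor
        (translateMulti (-(w • EuclideanSpace.single 0 1 : E4)) (linActMulti (planeRot (0 : Fin 3) s) Z))) =
      S₁ (m + m) ((osAdjoint (translateMulti (-(g • EuclideanSpace.single 0 1 : E4)) Z)).appendTensor
        (translateMulti ((2 * g - 2 * w * Real.cos s) • EuclideanSpace.single 0 1 +
            (-2 * w * Real.sin s) • EuclideanSpace.single 1 1 : E4)
          (translateMulti (-(g • EuclideanSpace.single 0 1 : E4)) Z))) := by
  have hv0 : 0 ≤ ((2 * g - 2 * w * Real.cos s) • EuclideanSpace.single 0 1 +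
      (-2 * w * Real.sin s) • EuclideanSpace.single 1 1 : E4) 0 := by
    simp
    linarith [mul_le_of_le_one_right hw (Real.cos_le_one s)]
  have h4off := OSReconstructionNoE1.isOffDiagonal_appendTensor_osAdjoint hY
    (OSReconstructionNoE1.isTimeOrdered_translateMulti hY hv0)
  rw [← hT _ (-(w • EuclideanSpace.single 0 1 : E4)) _
      (OSReconstructionNoE1.isOffDiagonal_appendTensor_osAdjoint hWm hWp),
    ← hT _ (-(g • EuclideanSpace.single 0 1 : E4)) _ h4off, ← hrot s _ (isOffDiagonal_translateMulti h4off _)]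
  congr 1
  ext x
  -- both sides are `conj (Z _) * Z _`; compare the arguments coordinatewise
  simp only [SchwartzMap.appendTensor_apply, osAdjoint_apply, linActMulti_apply, translateMulti_apply,
    Function.comp_apply, planeRot_symm_apply, neg_neg]
  refine congrArg₂ (fun a b => conj (Z a) * Z b) ?_ ?_
  · funext i
    ext j
    fin_cases j <;> simp [planeRot_apply, timeReflection_apply, Real.cos_neg, Real.sin_neg]
    ring
  · funext i
    ext j
    fin_cases j <;> simp [planeRot_apply, Real.cos_neg, Real.sin_neg] <;> ring

/-- `ΘF* ⊗ τ_v F` is a tensor witness for the pair `(F, τ_a τ_b F)` when `a + b = v`. -/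
theorem isAppendTensorOf_translate {n : ℕ} (F : 𝓢((Fin n → E4), ℂ)) (a b v : E4) (hv : a + b = v) :
    IsAppendTensorOf ((osAdjoint F).appendTensor (translateMulti v F)) (osAdjoint F)
      (translateMulti a (translateMulti b F)) := by
  intro x
  rw [SchwartzMap.appendTensor_apply, translateMulti_translateMulti, hv]

/-- **The blocks of the signature in the rotating frame.**  With `Z = τ_{-R_θ c⃗}(R_θ · Y)`
(`R_θ c⃗ = (cos θ c₁ + sin θ c₂) e₀ + (-sin θ c₁ + cos θ c₂) e₁`):
`W_{θ+s}^t := τ_{-(R_{θ+s} c⃗ + t e₀)}(R_{θ+s} · Y) = τ_{-t e₀}(R_s · Z)` (angle addition). -/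
theorem block_add (Y : 𝓢((Fin m → E4), ℂ)) (c : ℝ × ℝ) (θ : ℝ) {Z : 𝓢((Fin m → E4), ℂ)}
    (hZ : Z = translateMulti (-((Real.cos θ * c.1 + Real.sin θ * c.2) • EuclideanSpace.single 0 1 +
      (-Real.sin θ * c.1 + Real.cos θ * c.2) • EuclideanSpace.single 1 1))
        (linActMulti (planeRot (0 : Fin 3) θ) Y)) (s t : ℝ) :
    translateMulti (-((Real.cos (θ + s) * c.1 + Real.sin (θ + s) * c.2 + t) • EuclideanSpace.single 0 1 +
          (-Real.sin (θ + s) * c.1 + Real.cos (θ + s) * c.2) • EuclideanSpace.single 1 1))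
        (linActMulti (planeRot (0 : Fin 3) (θ + s)) Y) =
      translateMulti (-(t • EuclideanSpace.single 0 1 : E4)) (linActMulti (planeRot (0 : Fin 3) s) Z) := by
  rw [hZ, linActMulti_translateMulti, linActMulti_planeRot_planeRot, translateMulti_translateMulti,
    add_comm s θ]
  refine congrArg (fun v : E4 => translateMulti v (linActMulti (planeRot (0 : Fin 3) (θ + s)) Y)) ?_
  ext j
  fin_cases j <;> simp [planeRot_apply, Real.cos_add, Real.sin_add] <;> ring

/-- `W_θ^t = τ_{-t e₀} Z` (same `Z`). -/
theorem block_self (Y : 𝓢((Fin m → E4), ℂ)) (c : ℝ × ℝ) (θ : ℝ) {Z : 𝓢((Fin m → E4), ℂ)}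
    (hZ : Z = translateMulti (-((Real.cos θ * c.1 + Real.sin θ * c.2) • EuclideanSpace.single 0 1 +
      (-Real.sin θ * c.1 + Real.cos θ * c.2) • EuclideanSpace.single 1 1))
        (linActMulti (planeRot (0 : Fin 3) θ) Y)) (t : ℝ) :
    translateMulti (-((Real.cos θ * c.1 + Real.sin θ * c.2 + t) • EuclideanSpace.single 0 1 +
          (-Real.sin θ * c.1 + Real.cos θ * c.2) • EuclideanSpace.single 1 1))
        (linActMulti (planeRot (0 : Fin 3) θ) Y) =
      translateMulti (-(t • EuclideanSpace.single 0 1 : E4)) Z := by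
  rw [hZ, translateMulti_translateMulti]
  refine congrArg (fun v : E4 => translateMulti v (linActMulti (planeRot (0 : Fin 3) θ) Y)) ?_
  ext j
  fin_cases j <;> simp

end LowerBlock

open LowerBlock in
/-- **Stub (T5) — the reserve-aware lower block does not grow when the doubled degree is planar-invariant
(model-blind).**  For the `e₀`-reconstruction `h` of a translation-invariant `S₁` with a cone family `N`, a degree
`m` in which `𝔖_{m+m}` is invariant on `⁰𝒮` under the rotations of the `(x₀,x₁)`-plane, and a family `V'`
holomorphic on the rectangle `{|Re ζ| < ε, |Im ζ| < R}` whose real values are the field vectors of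
`W_θ = τ_{-(R_θ c + w e₀)} R_θ Y` (`w > 0`): if `w·e^R ≤ g` (and the `2g`-advanced blocks are time-ordered), then
`‖V' ζ‖ ≤ ‖Ψ_{τ_{-(R_θ c + g e₀)} R_θ Y}‖` at `θ = Re ζ`.  Registered signature of the skeleton
`Cruxes/SoftKernelBoostCovariance/Lines/Sketch.lean`, verbatim.  Proof: module docstring. -/
theorem stub_lowerBlock :
    open Literature.MathematicalPhysics.QuantumLattice Literature.MathematicalPhysics.AQFT
      Literature.MathematicalPhysics.QuantumFieldTheory
      Summit.QuantumFields.YangMills.Theorems.CurvatureBoostCovariance.Negative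
      Summit.QuantumFields.YangMills.Theorems.NPointIsotropy.Negative in
    ∀ (S₁ : SchwingerFamily E4) (h : OSReconstructionNoE1 S₁.toLabelled)
      (N : ℂ × ℂ → (h.Hilbert →L[ℂ] h.Hilbert)),
      (∀ p : ℂ × ℂ, |p.2.im| < p.1.re → ‖N p‖ ≤ 1) →
      (∀ ψ ψ' : h.Hilbert, DifferentiableOn ℂ (fun p : ℂ × ℂ => ⟪ψ, N p ψ'⟫_ℂ) {p : ℂ × ℂ | |p.2.im| < p.1.re}) →
      (∀ (t b : ℝ), 0 < t → ∀ ψ : h.Hilbert,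
        N ((t : ℂ), (b : ℂ)) ψ = h.transfer t (h.translate (b • EuclideanSpace.single 1 1) ψ)) →
      Translations S₁ →
      ∀ (m : ℕ) (Y : SchwartzMap (Fin m → E4) ℂ) (c : ℝ × ℝ) (w g ε R : ℝ) (V' : ℂ → h.Hilbert),
        0 < w → 0 < ε → 0 < R → w * Real.exp R ≤ g →
        (∀ (θ : ℝ) (F : SchwartzMap (Fin (m + m) → E4) ℂ), IsOffDiagonal F →
          S₁ (m + m) (linActMulti (planeRot (0 : Fin 3) θ) F) = S₁ (m + m) F) →
        DifferentiableOn ℂ V' {ζ : ℂ | |ζ.re| < ε ∧ |ζ.im| < R} →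
        (∀ θ : ℝ, |θ| < ε →
          ∃ hθ : IsTimeOrdered (translateMulti
                (-((Real.cos θ * c.1 + Real.sin θ * c.2 + w) • EuclideanSpace.single 0 1 +
                  (-Real.sin θ * c.1 + Real.cos θ * c.2) • EuclideanSpace.single 1 1))
                (linActMulti (planeRot (0 : Fin 3) θ) Y)),
            V' θ = h.fieldVec m (fun _ => ()) (translateMulti
                  (-((Real.cos θ * c.1 + Real.sin θ * c.2 + w) • EuclideanSpace.single 0 1 +
                    (-Real.sin θ * c.1 + Real.cos θ * c.2) • EuclideanSpace.single 1 1))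
                  (linActMulti (planeRot (0 : Fin 3) θ) Y)) hθ) →
        (∀ θ : ℝ, |θ| < ε → IsTimeOrdered (translateMulti
              (-((Real.cos θ * c.1 + Real.sin θ * c.2 + 2 * g) • EuclideanSpace.single 0 1 +
                (-Real.sin θ * c.1 + Real.cos θ * c.2) • EuclideanSpace.single 1 1))
              (linActMulti (planeRot (0 : Fin 3) θ) Y))) →
        ∀ ζ : ℂ, |ζ.re| < ε → |ζ.im| < R →
          ∀ hY : IsTimeOrdered (translateMulti
                (-((Real.cos ζ.re * c.1 + Real.sin ζ.re * c.2 + g) • EuclideanSpace.single 0 1 +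
                  (-Real.sin ζ.re * c.1 + Real.cos ζ.re * c.2) • EuclideanSpace.single 1 1))
                (linActMulti (planeRot (0 : Fin 3) ζ.re) Y)),
          ‖V' ζ‖ ≤ ‖h.fieldVec m (fun _ => ()) (translateMulti
                (-((Real.cos ζ.re * c.1 + Real.sin ζ.re * c.2 + g) • EuclideanSpace.single 0 1 +
                  (-Real.sin ζ.re * c.1 + Real.cos ζ.re * c.2) • EuclideanSpace.single 1 1))
                (linActMulti (planeRot (0 : Fin 3) ζ.re) Y)) hY‖ := by
  intro S₁ h N hN1 hN2 hN3 hT m Y c w g ε R V' hw hε hR hwg hrot hV' hreal _ ζ hζre hζim hY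
  -- the rotating frame `Z = τ_{-R_θ c⃗}(R_θ · Y)` at `θ = Re ζ`; the block `W_θ^g = τ_{-g e₀} Z`, its vector
  obtain ⟨Z, hZ⟩ : ∃ Z : 𝓢((Fin m → E4), ℂ), Z = translateMulti
      (-((Real.cos ζ.re * c.1 + Real.sin ζ.re * c.2) • EuclideanSpace.single 0 1 +
        (-Real.sin ζ.re * c.1 + Real.cos ζ.re * c.2) • EuclideanSpace.single 1 1))
      (linActMulti (planeRot (0 : Fin 3) ζ.re) Y) := ⟨_, rfl⟩
  have hbg := block_self Y c ζ.re hZ g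
  set Ψ : h.Hilbert := h.fieldVec m (fun _ => ()) _ hY with hΨ
  have hΨ' : Ψ = h.fieldVec m (fun _ => ()) _ (hbg ▸ hY) := fieldVec_congr h hbg hY _
  have hε' : 0 < ε - |ζ.re| := sub_pos.2 hζre
  have hwg' : w < g := (lt_mul_of_one_lt_right hw (Real.one_lt_exp_iff.2 hR)).trans_le hwg
  -- the shifted family `V(z) = V'(θ + z)`, the curve `q` and the matrix element `Φ`
  set V : ℂ → h.Hilbert := fun z => V' ((ζ.re : ℂ) + z) with hV
  set q : ℂ → ℂ × ℂ := fun z =>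
    (2 * (g : ℂ) - 2 * (w : ℂ) * Complex.cos z, -2 * (w : ℂ) * Complex.sin z) with hq
  set Φ : ℂ → ℂ := fun z => ⟪Ψ, N (q z) Ψ⟫_ℂ with hΦ
  have hVd : DifferentiableOn ℂ V {z : ℂ | |z.re| < ε - |ζ.re| ∧ |z.im| < R} := by
    refine hV'.comp ((differentiableOn_const _).add differentiableOn_id) fun z hz => ?_
    simp only [Set.mem_setOf_eq, Complex.add_re, Complex.ofReal_re, Complex.add_im, Complex.ofReal_im,
      zero_add] at hz ⊢
    exact ⟨(abs_add_le _ _).trans_lt (by linarith [hz.1]), hz.2⟩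
  have hqd : Differentiable ℂ q :=
    ((differentiable_const _).sub (Complex.differentiable_cos.const_mul _)).prodMk
      (Complex.differentiable_sin.const_mul _)
  have hΦd : DifferentiableOn ℂ Φ {z : ℂ | |z.re| < ε - |ζ.re| ∧ |z.im| < R} :=
    (hN2 Ψ Ψ).comp hqd.differentiableOn fun z hz => curve_mem_tube hw hwg hz.2
  -- the real values: `⟪V(-s), V(s)⟫ = 𝔖(Θ(W_{θ-s}^w)* ⊗ W_{θ+s}^w) = 𝔖(Θ(W_θ^g)* ⊗ τ_v W_θ^g) = Φ(s)`
  have hrealV : ∀ s : ℝ, |s| < ε - |ζ.re| → ⟪V (-(s : ℂ)), V s⟫_ℂ = Φ s := by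
    intro s hs
    obtain ⟨hWm, hVm⟩ := hreal (ζ.re - s) ((abs_sub _ _).trans_lt (by linarith))
    obtain ⟨hWp, hVp⟩ := hreal (ζ.re + s) ((abs_add_le _ _).trans_lt (by linarith))
    -- the blocks in the rotating frame: `W_{θ±s}^w = τ_{-w e₀}(R_{±s} · Z)`
    have hbp := block_add Y c ζ.re hZ s w
    have hbm := block_add Y c ζ.re hZ (-s) w
    simp only [← sub_eq_add_neg] at hbm
    -- the right side: `N` at the real point `(t, b)` acts by `e^{-tH} U(b e₁)`, `t e₀ + b e₁ = v`
    have ht : 0 < 2 * g - 2 * w * Real.cos s := by linarith [mul_le_of_le_one_right hw.le (Real.cos_le_one s)]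
    have hv : (SchwingerFamily.timeVec (2 * g - 2 * w * Real.cos s) : E4) +
        spatialPart 0 ((-2 * w * Real.sin s) • EuclideanSpace.single 1 1 : E4) =
        ((2 * g - 2 * w * Real.cos s) • EuclideanSpace.single 0 1 +
          (-2 * w * Real.sin s) • EuclideanSpace.single 1 1 : E4) := by
      ext j
      fin_cases j <;> simp [SchwingerFamily.timeVec, spatialPart_apply]
    have hqs : q s = (((2 * g - 2 * w * Real.cos s : ℝ) : ℂ), ((-2 * w * Real.sin s : ℝ) : ℂ)) := by
      simp only [hq]
      push_cast
      rfl
    simp only [hV, hΦ]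
    rw [show (ζ.re : ℂ) + -(s : ℂ) = ((ζ.re - s : ℝ) : ℂ) by push_cast; ring,
      show (ζ.re : ℂ) + (s : ℂ) = ((ζ.re + s : ℝ) : ℂ) by push_cast; rfl, hVm, hVp,
      fieldVec_congr h hbm hWm (hbm ▸ hWm), fieldVec_congr h hbp hWp (hbp ▸ hWp),
      inner_fieldVec_fieldVec_one h (hbm ▸ hWm) (hbp ▸ hWp),
      pairing S₁ hT hrot Z hw.le hwg'.le s (hbm ▸ hWm) (hbp ▸ hWp) (hbg ▸ hY), hqs, hN3 _ _ ht Ψ, hΨ',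
      h.translate_fieldVec, h.transfer_fieldVec ht.le,
      h.inner_fieldVec_fieldVec (F := translateMulti (-(g • EuclideanSpace.single 0 1 : E4)) Z) _ _
        (hbg ▸ hY) _ (isAppendTensorOf_translate _ _ _ _ hv)]
    rfl
  -- the identity theorem at `s = i Im ζ`
  have hmem : |(((ζ.im : ℂ) * Complex.I : ℂ)).re| < ε - |ζ.re| ∧ |((ζ.im : ℂ) * Complex.I).im| < R :=
    ⟨by simpa using hε', by simpa using hζim⟩
  have key := inner_eq_of_ofReal hε' hR hVd hΦd hrealV hmem
  rw [show -conj ((ζ.im : ℂ) * Complex.I) = (ζ.im : ℂ) * Complex.I by simp [Complex.conj_ofReal],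
    show V ((ζ.im : ℂ) * Complex.I) = V' ζ by simp only [hV, Complex.re_add_im]] at key
  -- `‖V' ζ‖² = Φ(i Im ζ) ≤ ‖Ψ‖ ‖N‖ ‖Ψ‖ ≤ ‖Ψ‖²` (the curve point lies in the tube)
  have hsq : ‖V' ζ‖ ^ 2 ≤ ‖Ψ‖ ^ 2 :=
    calc ‖V' ζ‖ ^ 2 = (⟪V' ζ, V' ζ⟫_ℂ).re := (inner_self_eq_norm_sq (𝕜 := ℂ) (V' ζ)).symm
      _ = (Φ ((ζ.im : ℂ) * Complex.I)).re := by rw [key]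
      _ ≤ ‖Φ ((ζ.im : ℂ) * Complex.I)‖ := Complex.re_le_norm _
      _ ≤ ‖Ψ‖ * ‖N (q ((ζ.im : ℂ) * Complex.I)) Ψ‖ := norm_inner_le_norm _ _
      _ ≤ ‖Ψ‖ * (‖N (q ((ζ.im : ℂ) * Complex.I))‖ * ‖Ψ‖) := by gcongr; exact (N _).le_opNorm Ψ
      _ ≤ ‖Ψ‖ * (1 * ‖Ψ‖) := by gcongr; exact hN1 _ (curve_mem_tube hw hwg hmem.2)
      _ = ‖Ψ‖ ^ 2 := by ring
  exact (sq_le_sq₀ (norm_nonneg _) (norm_nonneg _)).1 hsq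

end Summit.QuantumFields.YangMills.Theorems.SoftKernelBoostCovariance.Sketch
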